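import Summits.QuantumFields.BalabanUV.Beta.CombHId2Folds
import Summits.QuantumFields.BalabanUV.Beta.CombHId2W2Vertex2

/-!
# `BalabanUV.Beta.CombHId2FoldsSlots` — binder row D1 (OWNER an2), (J-a) dictionary, (C2) at ORDER 2, PART THREE (letters, 2c-i): **THE RECORD-SHAPE SECOND-ORDER
# SLOTS `S₂^{per,csf}` AND `M₂^{per,cs}` ARE DOUBLY PERIODIC AND DECAYING — THE FOLDS OF `CombHId2Folds` APPLY TO THEM**

WHY.  PART TWO-c delivered the door-bound `W` slot as `W2SymOfK K N S^per Mt^per S₂^{per,csf} M₂^{per,cs}` (`CombHId2W2Record.WcombOf_per_cs_eq`) with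
`S₂^{per,csf} κ u κ′ u′ := dper M (x z ↦ Σ'_n S₂ κ u κ′ (u′+M∘n) x z)` and `M₂^{per,cs} κ u ρ w := dper M (x z ↦ Σ'_n M₂ κ u ρ (w+M′∘n) x z)`.  `CombHId2Folds` reads the
nested words `vertex2OfK` ∕ `mixOfK` over ANY doubly periodic decaying family on the box × box.  This file checks the three sockets (inner periodicity, outer
periodicity, entrywise decay) for the two record-shape slots from the record's letters — `LocStencil₂` + joint block covariance `(T2t)` for `S₂`, `LocStencilFM` + the
mixed table's joint period covariance `(Tmix)` for `M₂` — and states the folds for them.  The KEY FACT (g44 N-an2-g44-1): the slots carry `dper` INSIDE, so the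
outer periodicity is EXACT (`CombHId2Torus.dper_tsum_csf_translate_outer`; here its mixed twin `dper_tsum_cs_translate_outer`), and no coupling between the two
period sums arises.
WHAT ([folklore]; 0 `def`, 0 cited fact, 0 `def … : Prop`, 0 sorry): §1 `csf_per_translate_inner`, `csf_per_translate_outer`, `decays_csf_per` (PART TWO-c
`CombHId2W2Vertex2.biLoc_S₂_csf` + gan24-p3's `decays_dper_diag`), **`vertex2OfK_csf_per_apply`**, **`perF_vertex2OfK_csf_per`** (`perF M (vertex2OfK K N S₂^{per,csf} μ y ν y′) P Q
= Σ_{u,κ} Σ_{u′,κ′} Â((u, inl κ),(wrapPt M (N•y), inr μ)) · (Â((u′, inl κ′),(wrapPt M (N•y′), inr ν)) · perF M (S₂^{per,csf} κ u κ′ u′) P Q)`, `Â := perF M K`),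
`decays_vertex2OfK_csf_per`; §2 `cs_per_translate_inner`, **`dper_tsum_cs_translate_outer`** (the mixed twin of `CombHId2Torus` §6: `M₂^{per,cs}` is EXACTLY `M`-periodic in its
fine bond — `CombHId2W2Mixed.M₂_fine_copy_eq_shiftK` + C3c `dper_shiftK_per`), `cs_per_translate_outer`, `decays_cs_per` (`CombHId2W2Words.biLoc_M₂_cs`), **`mixOfK_cs_per_apply`**,
**`perF_mixOfK_cs_per`** (`perF M (mixOfK K N M₂^{per,cs} μ y ν y′) P Q = Σ_{u,κ} Σ_{w∈pbox M′,ρ} Â((u, inl κ),(wrapPt M (N•y), inr μ)) · (Â((wrapPt M (N•w), inr ρ),(wrapPt M (N•y′), inr ν)) ·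
perF M (M₂^{per,cs} κ u ρ w) P Q)` — either order of the two bonds is this lemma), `decays_mixOfK_cs_per`.
NOT HERE: the record's `tabs` substituted and `W2SymOfK` assembled on the torus (`CombHId2TorusRecord`), the torus algebra (leaf-05's junction cert); nothing of
Bałaban's asserted; NOT D1, NEVER «G-an2-4 closed», NOT BetaPertH, NOT continuum, NOT Clay.

HONEST DEPENDENCY (page 1, mandatory): continuum YM on T⁴ ⇐ BetaPertH ∧ nine spine estimates (0/9 proved); BetaPertH ⇐ (D1) ∧ (D4) ∧ CAP+tail;
G-an2-4 gates asym, D1 and NE2/3/4.  HONEST FRAMING (cell contract, verbatim): «discharging `BetaPertH` makes Bałaban's UV stability UNCONDITIONAL —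
a real constructive-QFT result; it is NOT the continuum limit and NOT the Clay problem.»  ABSOLUTE RULE (cell charter, verbatim): «No internally-minted
statement may enter as a cited fact. Every hypothesis is either kernel-proved in this package or a verbatim quotation of a PUBLISHED theorem with page
reference. The manuscript(s) under audit are NOT citable for their own disputed steps — they are the thing under adjudication; programme-internal
(2001/route/tribunal) claims are never citable.»  Row D1 OWNER an2 (b2b-balaban-beta-an2) gen 45, 2026-08-23; over `CombHId2Folds`, `CombHId2Torus` §6, PART TWO-c BY NAME.
-/

noncomputable section

open scoped BigOperators Matrix

namespace Summit.QuantumFields.BalabanUV.Beta.CombHId2FoldsSlots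

open Literature.MathematicalPhysics.QuantumFieldTheory.Balaban1983to89
open Literature.MathematicalPhysics.QuantumFieldTheory.Balaban1983to89.Beta
open B4TorusKernel.MultiPeriod (translate translate_apply)
open B4Reflection242 (translate_translate)
open ExpKernelCalculus (MKer Decays BiLoc shiftK)
open AffineAveraging (Site)
open OneStepResolventKernel (Fib)
open BalabanCompositeJets (LocStencil₂)
open SecondOrderResponse (vertex2OfK mixOfK LocStencilFM)
open Summit.QuantumFields.BalabanUV.Beta.FP.KernelPeriodisationFib (Idx perF perZ)
open Summit.QuantumFields.BalabanUV.Beta.FP.KernelPeriodisationFibLoc (dper decays_dper_diag shiftK_eq_translate)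
open Summit.QuantumFields.BalabanUV.Beta.FP.TorusGaugeCovariancePairing (wrapPt)
open B4Sect5Proof (latticeConst latticeConst_nonneg)
open B6Lemma24Torus (pbox)
open Summit.QuantumFields.BalabanUV.Beta.CombHId2Product (translate_zero_right)
open Summit.QuantumFields.BalabanUV.Beta.CombHId2CopySum (dper_shiftK_per)
open Summit.QuantumFields.BalabanUV.Beta.CombHId2Torus (tsum_csf_translate_inner dper_tsum_csf_translate_outer)
open Summit.QuantumFields.BalabanUV.Beta.CombHId2W2Words (biLoc_M₂_cs)
open Summit.QuantumFields.BalabanUV.Beta.CombHId2W2Vertex2 (biLoc_S₂_csf)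
open Summit.QuantumFields.BalabanUV.Beta.CombHId2Folds (vertex2OfK_apply_of_periodic₂ perF_vertex2OfK_of_periodic₂' decays_vertex2OfK_of_periodic₂
  mixOfK_apply_of_periodic₂ perF_mixOfK_of_periodic₂' decays_mixOfK_of_periodic₂ abs_le_of_decays')

variable {d : ℕ} (M : Fin (d + 1) → ℕ) [∀ μ, NeZero (M μ)] {N : ℕ} [NeZero N] {M' : Fin (d + 1) → ℕ} {K : MKer (d + 1) (Fib d)} {CK δK : ℝ}

/-! ## §1 The periodised copy-summed second-order field slot `S₂^{per,csf}` -/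

section S2

variable {S₂ : Fin (d + 1) → Site (d + 1) → Fin (d + 1) → Site (d + 1) → MKer (d + 1) (Fib d)} {C₂ δ₂ : ℝ}

omit [∀ μ, NeZero (M μ)] [NeZero N] in
/-- [folklore] `S₂^{per,csf}` is EXACTLY `M`-periodic in its second bond (the copy sum absorbs the period — `CombHId2Torus.tsum_csf_translate_inner`). -/
theorem csf_per_translate_inner (S₂ : Fin (d + 1) → Site (d + 1) → Fin (d + 1) → Site (d + 1) → MKer (d + 1) (Fib d))
    (κ : Fin (d + 1)) (u : Site (d + 1)) (κ' : Fin (d + 1)) (u' m : Site (d + 1)) :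
    (fun κ u κ' u' => dper M (fun x z a c => ∑' n : Site (d + 1), S₂ κ u κ' (translate M u' n) x z a c)) κ u κ' (translate M u' m)
      = (fun κ u κ' u' => dper M (fun x z a c => ∑' n : Site (d + 1), S₂ κ u κ' (translate M u' n) x z a c)) κ u κ' u' := by
  show dper M _ = dper M _
  rw [tsum_csf_translate_inner M S₂ κ u κ' u' m]

omit [∀ μ, NeZero (M μ)] [NeZero N] in
/-- [folklore] … and EXACTLY `M`-periodic in its first bond (`M = N·M′`, joint block covariance `(T2t)` — `CombHId2Torus.dper_tsum_csf_translate_outer`). -/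
theorem csf_per_translate_outer (hM : ∀ i, M i = N * M' i)
    (hS₂s : ∀ (κ : Fin (d + 1)) (u : Site (d + 1)) (κ' : Fin (d + 1)) (u' t : Site (d + 1)),
      S₂ κ (u + (N : ℤ) • t) κ' (u' + (N : ℤ) • t) = shiftK (-((N : ℤ) • t)) (S₂ κ u κ' u'))
    (κ : Fin (d + 1)) (u m : Site (d + 1)) :
    (fun κ u κ' u' => dper M (fun x z a c => ∑' n : Site (d + 1), S₂ κ u κ' (translate M u' n) x z a c)) κ (translate M u m)
      = (fun κ u κ' u' => dper M (fun x z a c => ∑' n : Site (d + 1), S₂ κ u κ' (translate M u' n) x z a c)) κ u := by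
  funext κ' u'
  exact dper_tsum_csf_translate_outer M hM hS₂s κ u κ' u' m

/-- [folklore] `S₂^{per,csf}` decays entrywise, uniformly in the two bonds (PART TWO-c `biLoc_S₂_csf` + gan24-p3's `decays_dper_diag`). -/
theorem decays_csf_per (hS₂ : LocStencil₂ S₂ C₂ δ₂) (hδ₂ : 0 < δ₂) (κ : Fin (d + 1)) (u : Site (d + 1)) (κ' : Fin (d + 1)) (u' : Site (d + 1)) :
    Decays ((fun κ u κ' u' => dper M (fun x z a c => ∑' n : Site (d + 1), S₂ κ u κ' (translate M u' n) x z a c)) κ u κ' u')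
      (C₂ * latticeConst (d + 1) δ₂ * latticeConst (d + 1) (δ₂ / 2)) (δ₂ / 2) :=
  decays_dper_diag M (biLoc_S₂_csf M hS₂ hδ₂ κ u κ' u') ((biLoc_S₂_csf M hS₂ hδ₂ κ u κ' u').nonneg (Sum.inl 0)) hδ₂

omit [NeZero N] in
/-- [folklore] **THE BI-VERTEX OVER `S₂^{per,csf}`, READ ON THE BOX × BOX**:
`vertex2OfK K N S₂^{per,csf} μ y ν y′ x z a b = Σ_{u,κ} Σ_{u′,κ′} perZ M K u (N•y) (inl κ) (inr μ) · (perZ M K u′ (N•y′) (inl κ′) (inr ν) · S₂^{per,csf} κ u κ′ u′ x z a b)`. -/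
theorem vertex2OfK_csf_per_apply (hM : ∀ i, M i = N * M' i)
    (hKinv : ∀ (m x z : Site (d + 1)) (a b : Fib d), K (translate M x m) (translate M z m) a b = K x z a b)
    (hK : Decays K CK δK) (hδK : 0 < δK)
    (hS₂s : ∀ (κ : Fin (d + 1)) (u : Site (d + 1)) (κ' : Fin (d + 1)) (u' t : Site (d + 1)),
      S₂ κ (u + (N : ℤ) • t) κ' (u' + (N : ℤ) • t) = shiftK (-((N : ℤ) • t)) (S₂ κ u κ' u'))
    (hS₂ : LocStencil₂ S₂ C₂ δ₂) (hδ₂ : 0 < δ₂)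
    (μ : Fin (d + 1)) (y : Site (d + 1)) (ν : Fin (d + 1)) (y' x z : Site (d + 1)) (a b : Fib d) :
    vertex2OfK K N (fun κ u κ' u' => dper M (fun x z a c => ∑' n : Site (d + 1), S₂ κ u κ' (translate M u' n) x z a c)) μ y ν y' x z a b
      = ∑ u : ↥(pbox M), ∑ κ : Fin (d + 1), ∑ u' : ↥(pbox M), ∑ κ' : Fin (d + 1),
          perZ M K (u : Site (d + 1)) ((N : ℤ) • y) (Sum.inl κ) (Sum.inr μ)
            * (perZ M K (u' : Site (d + 1)) ((N : ℤ) • y') (Sum.inl κ') (Sum.inr ν)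
                * dper M (fun x z a c => ∑' n : Site (d + 1), S₂ κ (u : Site (d + 1)) κ' (translate M (u' : Site (d + 1)) n) x z a c) x z a b) :=
  vertex2OfK_apply_of_periodic₂ M hKinv hK hδK (csf_per_translate_outer M hM hS₂s) (csf_per_translate_inner M S₂)
    (fun κ u κ' u' x z a b => abs_le_of_decays' (decays_csf_per M hS₂ hδ₂ κ u κ' u') (half_pos hδ₂).le x z a b) μ y ν y' x z a b

omit [NeZero N] in
/-- [folklore] **`perF_vertex2OfK_csf_per` — THE SHAPE IN WHICH THE DOOR's `H₂` BINDS THE RECORD's BI-VERTEX**: with `Â := perF M K`,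
`perF M (vertex2OfK K N S₂^{per,csf} μ y ν y′) P Q = Σ_{u,κ} Σ_{u′,κ′} Â((u, inl κ),(wrapPt M (N•y), inr μ)) · (Â((u′, inl κ′),(wrapPt M (N•y′), inr ν)) · perF M (S₂^{per,csf} κ u κ′ u′) P Q)`. -/
theorem perF_vertex2OfK_csf_per (hM : ∀ i, M i = N * M' i)
    (hKinv : ∀ (m x z : Site (d + 1)) (a b : Fib d), K (translate M x m) (translate M z m) a b = K x z a b)
    (hK : Decays K CK δK) (hδK : 0 < δK)
    (hS₂s : ∀ (κ : Fin (d + 1)) (u : Site (d + 1)) (κ' : Fin (d + 1)) (u' t : Site (d + 1)),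
      S₂ κ (u + (N : ℤ) • t) κ' (u' + (N : ℤ) • t) = shiftK (-((N : ℤ) • t)) (S₂ κ u κ' u'))
    (hS₂ : LocStencil₂ S₂ C₂ δ₂) (hδ₂ : 0 < δ₂)
    (μ : Fin (d + 1)) (y : Site (d + 1)) (ν : Fin (d + 1)) (y' : Site (d + 1)) (P Q : Idx M (Fib d)) :
    perF M (vertex2OfK K N (fun κ u κ' u' => dper M (fun x z a c => ∑' n : Site (d + 1), S₂ κ u κ' (translate M u' n) x z a c)) μ y ν y') P Q
      = ∑ u : ↥(pbox M), ∑ κ : Fin (d + 1), ∑ u' : ↥(pbox M), ∑ κ' : Fin (d + 1),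
          perF M K (u, Sum.inl κ) (wrapPt M ((N : ℤ) • y), Sum.inr μ)
            * (perF M K (u', Sum.inl κ') (wrapPt M ((N : ℤ) • y'), Sum.inr ν)
                * perF M (dper M (fun x z a c => ∑' n : Site (d + 1), S₂ κ (u : Site (d + 1)) κ' (translate M (u' : Site (d + 1)) n) x z a c)) P Q) :=
  perF_vertex2OfK_of_periodic₂' M hKinv hK hδK (csf_per_translate_outer M hM hS₂s) (csf_per_translate_inner M S₂) (decays_csf_per M hS₂ hδ₂)
    (half_pos hδ₂) μ y ν y' P Q

omit [NeZero N] in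
/-- [folklore] the record-shape bi-vertex decays (a summability letter for the torus split of `W2OfK`). -/
theorem decays_vertex2OfK_csf_per (hM : ∀ i, M i = N * M' i)
    (hKinv : ∀ (m x z : Site (d + 1)) (a b : Fib d), K (translate M x m) (translate M z m) a b = K x z a b)
    (hK : Decays K CK δK) (hδK : 0 < δK)
    (hS₂s : ∀ (κ : Fin (d + 1)) (u : Site (d + 1)) (κ' : Fin (d + 1)) (u' t : Site (d + 1)),
      S₂ κ (u + (N : ℤ) • t) κ' (u' + (N : ℤ) • t) = shiftK (-((N : ℤ) • t)) (S₂ κ u κ' u'))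
    (hS₂ : LocStencil₂ S₂ C₂ δ₂) (hδ₂ : 0 < δ₂) (μ : Fin (d + 1)) (y : Site (d + 1)) (ν : Fin (d + 1)) (y' : Site (d + 1)) :
    ∃ C : ℝ, 0 ≤ C ∧ Decays (vertex2OfK K N (fun κ u κ' u' => dper M (fun x z a c => ∑' n : Site (d + 1), S₂ κ u κ' (translate M u' n) x z a c)) μ y ν y')
      C (δ₂ / 2) := by
  have h := decays_vertex2OfK_of_periodic₂ M (N := N) hKinv hK hδK (csf_per_translate_outer M hM hS₂s) (csf_per_translate_inner M S₂)
    (decays_csf_per M hS₂ hδ₂) (half_pos hδ₂) μ y ν y'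
  exact ⟨_, h.nonneg (Sum.inl 0), h⟩

end S2

/-! ## §2 The periodised copy-summed mixed slot `M₂^{per,cs}` -/

section M2

variable {M₂ : Fin (d + 1) → Site (d + 1) → Fin (d + 1) → Site (d + 1) → MKer (d + 1) (Fib d)} {Cm δm : ℝ}

omit [∀ μ, NeZero (M μ)] [NeZero N] in
/-- [folklore] `M₂^{per,cs}` is EXACTLY `M′`-periodic in its coarse bond (re-indexing the copy sum `n ↦ m + n`). -/
theorem cs_per_translate_inner (M₂ : Fin (d + 1) → Site (d + 1) → Fin (d + 1) → Site (d + 1) → MKer (d + 1) (Fib d))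
    (κ : Fin (d + 1)) (u : Site (d + 1)) (ρ : Fin (d + 1)) (w m : Site (d + 1)) :
    (fun κ u ρ w => dper M (fun x z a c => ∑' n : Site (d + 1), M₂ κ u ρ (translate M' w n) x z a c)) κ u ρ (translate M' w m)
      = (fun κ u ρ w => dper M (fun x z a c => ∑' n : Site (d + 1), M₂ κ u ρ (translate M' w n) x z a c)) κ u ρ w := by
  show dper M _ = dper M _
  congr 1
  funext x z a c
  simp only [translate_translate]
  exact (Equiv.addLeft m).tsum_eq fun n => M₂ κ u ρ (translate M' w n) x z a c

omit [∀ μ, NeZero (M μ)] [NeZero N] in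
/-- [folklore] **`dper_tsum_cs_translate_outer` — `M₂^{per,cs}` IS EXACTLY `M`-PERIODIC IN ITS FINE BOND** (the mixed twin of `CombHId2Torus.dper_tsum_csf_translate_outer`):
moving the fine bond by `M∘m` is, copy by copy, a back-shift of the coarse copy index and a diagonal shift of the kernel arguments (the joint period covariance
`(Tmix)` in period form, `CombHId2W2Mixed.M₂_fine_copy_eq_shiftK`); the copy sum re-indexes and `dper` forgets the shift (C3c `dper_shiftK_per`). -/
theorem dper_tsum_cs_translate_outer
    (hM₂t : ∀ (κ : Fin (d + 1)) (u : Site (d + 1)) (ρ : Fin (d + 1)) (w m x z : Site (d + 1)) (a c : Fib d),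
      M₂ κ (translate M u m) ρ (translate M' w m) (translate M x m) (translate M z m) a c = M₂ κ u ρ w x z a c)
    (κ : Fin (d + 1)) (u m : Site (d + 1)) (ρ : Fin (d + 1)) (w : Site (d + 1)) :
    dper M (fun x z a c => ∑' n : Site (d + 1), M₂ κ (translate M u m) ρ (translate M' w n) x z a c)
      = dper M (fun x z a c => ∑' n : Site (d + 1), M₂ κ u ρ (translate M' w n) x z a c) := by
  have key : (fun x z a c => ∑' n : Site (d + 1), M₂ κ (translate M u m) ρ (translate M' w n) x z a c)
      = shiftK (fun i => (M i : ℤ) * (-m) i) (fun x z a c => ∑' n : Site (d + 1), M₂ κ u ρ (translate M' w n) x z a c) := by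
    funext x z a c
    rw [shiftK_eq_translate, ← (Equiv.addRight m).tsum_eq fun n => M₂ κ (translate M u m) ρ (translate M' w n) x z a c]
    refine tsum_congr fun n => ?_
    have h := hM₂t κ u ρ (translate M' w n) m (translate M x (-m)) (translate M z (-m)) a c
    rw [translate_translate, translate_translate, translate_translate, neg_add_cancel, translate_zero_right, translate_zero_right] at h
    exact h
  rw [key, dper_shiftK_per]

omit [∀ μ, NeZero (M μ)] [NeZero N] in
/-- [folklore] … as an equality of the inner coarse-bond families. -/
theorem cs_per_translate_outer
    (hM₂t : ∀ (κ : Fin (d + 1)) (u : Site (d + 1)) (ρ : Fin (d + 1)) (w m x z : Site (d + 1)) (a c : Fib d),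
      M₂ κ (translate M u m) ρ (translate M' w m) (translate M x m) (translate M z m) a c = M₂ κ u ρ w x z a c)
    (κ : Fin (d + 1)) (u m : Site (d + 1)) :
    (fun κ u ρ w => dper M (fun x z a c => ∑' n : Site (d + 1), M₂ κ u ρ (translate M' w n) x z a c)) κ (translate M u m)
      = (fun κ u ρ w => dper M (fun x z a c => ∑' n : Site (d + 1), M₂ κ u ρ (translate M' w n) x z a c)) κ u := by
  funext ρ w
  exact dper_tsum_cs_translate_outer M hM₂t κ u m ρ w

omit [NeZero N] in
/-- [folklore] `M₂^{per,cs}` decays entrywise, uniformly in the two bonds (PART TWO-c `biLoc_M₂_cs` + gan24-p3's `decays_dper_diag`). -/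
theorem decays_cs_per (hM : ∀ i, M i = N * M' i) (hM₂ : LocStencilFM N M₂ Cm δm) (hδm : 0 < δm)
    (κ : Fin (d + 1)) (u : Site (d + 1)) (ρ : Fin (d + 1)) (w : Site (d + 1)) :
    Decays ((fun κ u ρ w => dper M (fun x z a c => ∑' n : Site (d + 1), M₂ κ u ρ (translate M' w n) x z a c)) κ u ρ w)
      (Cm * latticeConst (d + 1) δm * latticeConst (d + 1) (δm / 2)) (δm / 2) :=
  decays_dper_diag M (biLoc_M₂_cs M hM hM₂ hδm κ u ρ w) ((biLoc_M₂_cs M hM hM₂ hδm κ u ρ w).nonneg (Sum.inl 0)) hδm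

/-- [folklore] **THE MIXED BI-VERTEX OVER `M₂^{per,cs}`, READ ON THE BOX × COARSE BOX** (`M = N·M′`):
`mixOfK K N M₂^{per,cs} μ y ν y′ x z a b = Σ_{u,κ} Σ_{w∈pbox M′,ρ} perZ M K u (N•y) (inl κ) (inr μ) · (perZ M K (N•w) (N•y′) (inr ρ) (inr ν) · M₂^{per,cs} κ u ρ w x z a b)` — either order of
the two bonds of `W2OfK`'s two mixed words is this lemma with `(μ,y) ↔ (ν,y′)`. -/
theorem mixOfK_cs_per_apply [∀ μ, NeZero (M' μ)] (hM : ∀ i, M i = N * M' i)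
    (hKinv : ∀ (m x z : Site (d + 1)) (a b : Fib d), K (translate M x m) (translate M z m) a b = K x z a b)
    (hK : Decays K CK δK) (hδK : 0 < δK)
    (hM₂t : ∀ (κ : Fin (d + 1)) (u : Site (d + 1)) (ρ : Fin (d + 1)) (w m x z : Site (d + 1)) (a c : Fib d),
      M₂ κ (translate M u m) ρ (translate M' w m) (translate M x m) (translate M z m) a c = M₂ κ u ρ w x z a c)
    (hM₂ : LocStencilFM N M₂ Cm δm) (hδm : 0 < δm)
    (μ : Fin (d + 1)) (y : Site (d + 1)) (ν : Fin (d + 1)) (y' x z : Site (d + 1)) (a b : Fib d) :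
    mixOfK K N (fun κ u ρ w => dper M (fun x z a c => ∑' n : Site (d + 1), M₂ κ u ρ (translate M' w n) x z a c)) μ y ν y' x z a b
      = ∑ u : ↥(pbox M), ∑ κ : Fin (d + 1), ∑ w : ↥(pbox M'), ∑ ρ : Fin (d + 1),
          perZ M K (u : Site (d + 1)) ((N : ℤ) • y) (Sum.inl κ) (Sum.inr μ)
            * (perZ M K ((N : ℤ) • (w : Site (d + 1))) ((N : ℤ) • y') (Sum.inr ρ) (Sum.inr ν)
                * dper M (fun x z a c => ∑' n : Site (d + 1), M₂ κ (u : Site (d + 1)) ρ (translate M' (w : Site (d + 1)) n) x z a c) x z a b) :=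
  mixOfK_apply_of_periodic₂ M hM hKinv hK hδK (cs_per_translate_outer M hM₂t) (cs_per_translate_inner M M₂)
    (fun κ u ρ w x z a b => abs_le_of_decays' (decays_cs_per M hM hM₂ hδm κ u ρ w) (half_pos hδm).le x z a b) μ y ν y' x z a b

/-- [folklore] **`perF_mixOfK_cs_per` — THE SHAPE IN WHICH THE DOOR's `Q₁₂` BINDS THE RECORD's MIXED BI-VERTEX**: with `Â := perF M K`,
`perF M (mixOfK K N M₂^{per,cs} μ y ν y′) P Q = Σ_{u,κ} Σ_{w∈pbox M′,ρ} Â((u, inl κ),(wrapPt M (N•y), inr μ)) · (Â((wrapPt M (N•w), inr ρ),(wrapPt M (N•y′), inr ν)) · perF M (M₂^{per,cs} κ u ρ w) P Q)`. -/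
theorem perF_mixOfK_cs_per [∀ μ, NeZero (M' μ)] (hM : ∀ i, M i = N * M' i)
    (hKinv : ∀ (m x z : Site (d + 1)) (a b : Fib d), K (translate M x m) (translate M z m) a b = K x z a b)
    (hK : Decays K CK δK) (hδK : 0 < δK)
    (hM₂t : ∀ (κ : Fin (d + 1)) (u : Site (d + 1)) (ρ : Fin (d + 1)) (w m x z : Site (d + 1)) (a c : Fib d),
      M₂ κ (translate M u m) ρ (translate M' w m) (translate M x m) (translate M z m) a c = M₂ κ u ρ w x z a c)
    (hM₂ : LocStencilFM N M₂ Cm δm) (hδm : 0 < δm)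
    (μ : Fin (d + 1)) (y : Site (d + 1)) (ν : Fin (d + 1)) (y' : Site (d + 1)) (P Q : Idx M (Fib d)) :
    perF M (mixOfK K N (fun κ u ρ w => dper M (fun x z a c => ∑' n : Site (d + 1), M₂ κ u ρ (translate M' w n) x z a c)) μ y ν y') P Q
      = ∑ u : ↥(pbox M), ∑ κ : Fin (d + 1), ∑ w : ↥(pbox M'), ∑ ρ : Fin (d + 1),
          perF M K (u, Sum.inl κ) (wrapPt M ((N : ℤ) • y), Sum.inr μ)
            * (perF M K (wrapPt M ((N : ℤ) • (w : Site (d + 1))), Sum.inr ρ) (wrapPt M ((N : ℤ) • y'), Sum.inr ν)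
                * perF M (dper M (fun x z a c => ∑' n : Site (d + 1), M₂ κ (u : Site (d + 1)) ρ (translate M' (w : Site (d + 1)) n) x z a c)) P Q) :=
  perF_mixOfK_of_periodic₂' M hM hKinv hK hδK (cs_per_translate_outer M hM₂t) (cs_per_translate_inner M M₂) (decays_cs_per M hM hM₂ hδm)
    (half_pos hδm) μ y ν y' P Q

/-- [folklore] the record-shape mixed bi-vertex decays (summability letter). -/
theorem decays_mixOfK_cs_per [∀ μ, NeZero (M' μ)] (hM : ∀ i, M i = N * M' i)
    (hKinv : ∀ (m x z : Site (d + 1)) (a b : Fib d), K (translate M x m) (translate M z m) a b = K x z a b)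
    (hK : Decays K CK δK) (hδK : 0 < δK)
    (hM₂t : ∀ (κ : Fin (d + 1)) (u : Site (d + 1)) (ρ : Fin (d + 1)) (w m x z : Site (d + 1)) (a c : Fib d),
      M₂ κ (translate M u m) ρ (translate M' w m) (translate M x m) (translate M z m) a c = M₂ κ u ρ w x z a c)
    (hM₂ : LocStencilFM N M₂ Cm δm) (hδm : 0 < δm) (μ : Fin (d + 1)) (y : Site (d + 1)) (ν : Fin (d + 1)) (y' : Site (d + 1)) :
    ∃ C : ℝ, 0 ≤ C ∧ Decays (mixOfK K N (fun κ u ρ w => dper M (fun x z a c => ∑' n : Site (d + 1), M₂ κ u ρ (translate M' w n) x z a c)) μ y ν y')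
      C (δm / 2) := by
  have h := decays_mixOfK_of_periodic₂ M hM hKinv hK hδK (cs_per_translate_outer M hM₂t) (cs_per_translate_inner M M₂) (decays_cs_per M hM hM₂ hδm)
    (half_pos hδm) μ y ν y'
  exact ⟨_, h.nonneg (Sum.inl 0), h⟩

end M2

end Summit.QuantumFields.BalabanUV.Beta.CombHId2FoldsSlots

end
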